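import Literature.AnabelianGeometry.EtaleTheta.GalSectThm110iii
import Mathlib.GroupTheory.Index
import HarnessLib

/-!
# [EtTh] Thm. 1.10 (iii): the input (nX) «`Δ^tp_C ⊄ Π^tp_X`» ⟺ «`Ċ` is defined over the base field of `X`»

The X-level closers of Thm. 1.10 (iii) (`thm110iiiGalSect_of_Xlevel`, abc-iut-w5-d062 p442622, and its
`_twoTorsion` form p443938) take the input (nX) `¬ Ker(augC) ≤ Π^tp_X` for each cusp datum.  Print ([EtTh]
p. 27: `C := X/±1`, a hyperbolic orbicurve OVER `K`) says the augmentation of `Π^tp_C` has the SAME image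
`G_K` as that of `Π^tp_X`.  This file proves the two are EQUIVALENT for the [GalSect] Def. 4.1 carrier
`MuTwoSetting.DotCCusp` (index `[Π^tp_C : Π^tp_X] = 2`, `ε_± ∉ Π^tp_X`):

* `DotCCusp.not_ker_augC_le_range_of_sameField` — (sf) `∀ g, ∃ h, augC g = aug h` ⇒ (nX);
* `DotCCusp.sameField_of_not_ker_augC_le_range` — (nX) ⇒ (sf);
* `DotCCusp.not_ker_augC_le_range_iff_sameField`.

So (nX) may be read as the printed clause «`C` is defined over `K`».  HONEST FRAMING: nothing printed is
asserted; typed ≠ proved; no side taken on [IUTchIII] Cor. 3.12, on which nothing here bears.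
-/

namespace Literature.AnabelianGeometry.EtaleTheta

namespace MuTwoSetting.DotCCusp

variable {p : ℕ} [Fact p.Prime] {M : MuTwoSetting p} {εZ : M.GtpC} (C : M.DotCCusp εZ)

/-- **(sf) ⇒ (nX).**  If the augmentation of `Π^tp_C` takes values in the image `G_K` of that of `Π^tp_X`
(«`C` is defined over `K`», [EtTh] p. 27), then `Ker(augC) = Δ^tp_C` is NOT contained in `Π^tp_X`: the element
`ε_± · h⁻¹` (with `augC ε_± = aug h`) is geometric and outside `Π^tp_X`. [cite: MochizukiEtTh2009, Def 1.7 p.27] -/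
theorem not_ker_augC_le_range_of_sameField (hsf : ∀ g : M.GtpC, ∃ h : M.PiTemp, C.augC g = M.aug h) :
    ¬ C.augC.ker ≤ M.inclX.range := by
  intro hle
  obtain ⟨h, hh⟩ := hsf M.epsPM
  have hmem : M.epsPM * (M.inclX h)⁻¹ ∈ C.augC.ker := by
    rw [MonoidHom.mem_ker, map_mul, map_inv, C.augC_inclX, hh, mul_inv_cancel]
  obtain ⟨y, hy⟩ := hle hmem
  exact M.epsPM_not_mem ⟨y * h, by rw [map_mul, hy, inv_mul_cancel_right]⟩

/-- **(nX) ⇒ (sf).**  Conversely, if `Δ^tp_C ⊄ Π^tp_X`, then (as `[Π^tp_C : Π^tp_X] = 2`) every element of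
`Π^tp_C` is a geometric element times an element of `Π^tp_X`, so `augC` takes values in `aug(Π^tp_X) = G_K`.
[cite: MochizukiEtTh2009, Def 1.7 p.27] -/
theorem sameField_of_not_ker_augC_le_range (hnX : ¬ C.augC.ker ≤ M.inclX.range) (g : M.GtpC) :
    ∃ h : M.PiTemp, C.augC g = M.aug h := by
  by_cases hg : g ∈ M.inclX.range
  · obtain ⟨h, rfl⟩ := hg
    exact ⟨h, C.augC_inclX h⟩
  · obtain ⟨k, hk, hkX⟩ := Set.not_subset.mp hnX
    have hkg : k⁻¹ * g ∈ M.inclX.range := by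
      rw [Subgroup.mul_mem_iff_of_index_two M.index_range_inclX, inv_mem_iff]
      exact ⟨fun h => absurd h hkX, fun h => absurd h hg⟩
    obtain ⟨h, hh⟩ := hkg
    refine ⟨h, ?_⟩
    rw [← C.augC_inclX, hh, map_mul, map_inv, (MonoidHom.mem_ker).mp hk, inv_one, one_mul]

/-- **(nX) ⟺ (sf)**: `Δ^tp_C ⊄ Π^tp_X` iff the augmentation of `Π^tp_C` has image `G_K`.
[cite: MochizukiEtTh2009, Def 1.7 p.27] -/
theorem not_ker_augC_le_range_iff_sameField :
    (¬ C.augC.ker ≤ M.inclX.range) ↔ ∀ g : M.GtpC, ∃ h : M.PiTemp, C.augC g = M.aug h :=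
  ⟨C.sameField_of_not_ker_augC_le_range, C.not_ker_augC_le_range_of_sameField⟩

end MuTwoSetting.DotCCusp

end Literature.AnabelianGeometry.EtaleTheta
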